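import Summits.CriticalPhenomena.PercolationContinuityZ3.Theorems.PercNearOneGluingNoHeavyQuantGluedForestsTightShape4
import Summits.CriticalPhenomena.PercolationContinuityZ3.Theorems.PercNearOneGluingNoHeavyQuantShapeForestLong5
import HarnessLib

/-!
# QUANT lane R8, T-DEC: FORESTS OF GLUED SIBLINGS OF ARBITRARY SHAPES WHOSE TIGHT SIBLINGS SHARE ONE SHAPE `(lo₀, K₀)` ARE SDEC — any number of tight
# ones if `K₀ ≤ 2lo₀`, at most FIVE if `K₀ ≤ 4lo₀` (census-1 gen 35; `sdec_gluedForests_of_tightShape4` with its bound `4` raised to `5` by the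
# width-5 hub / `sdec_shapeForest_long5`) — THE KERNEL COVERAGE OF GLUED-SIBLING FORESTS AFTER census-1 g35

builds on p205010 (kernel theorem, internal audit signed; external expert review pending)

Support file (`--supports stmt-CriticalPhenomena-4575`), QUANT lane seat prim-quant-census-1 (gen 35); memo
`run/shared/lean/prim/quant/prim-quant-census-1/g35/QUADHUB-G35.md` §3.  Theorems only (no definitions), standard axioms, no sorries.  VERBATIM twin of
gen 34's `…QuantGluedForestsTightShape` calling `sdec_shapeForest_long5` (`…QuantShapeForestLong4`) in place of `sdec_shapeForest_long`.

THE STATEMENT.  Shapes as functions `lo K : Sib → ℕ`; `L` a list of glued siblings `s = ⟨q,·,·,lo s + K s,{lo s: 1−g, lo s + K s: g}⟩` (`1 ≤ lo s, K s`,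
`0 < q, g < 1`, `x ≤ qg`); TIGHT means `2·lo s < q·mean < lo s + (K s)·x`.  If every tight sibling has the shape `(lo₀, K₀)` and either `lo₀ < K₀ ≤ 2lo₀`
(any number of them) or `lo₀ < K₀ ≤ 4lo₀` with at most FIVE of them, then `SDEC x (ftop L) (flaw L)`.  With gen 34's `sdec_gluedForests_of_oneTight`
(≤ 1 tight, shapes free): **the residue of the glued-sibling step is ≥ 2 simultaneously tight siblings that are NOT a one-shape family with `K₀ ≤ 2lo₀`,
nor ≤ 5 of one shape with `K₀ ≤ 4lo₀`.**
* **`sdec_gluedForests_of_tightShape5`**, **`sdec_forest_gluedTightShapeCore5`** (node-shaped: plus GOOD siblings, any order, `0 < x < 1`).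

HONEST STATUS.  `SiblingStep`, `GluedDominatedMass`, `SDECConvClosed`, `FarTreeRow` OPEN; RATE class (log\*) / honest sentence of
`run/shared/lean/prim/quant/README.md` unchanged.  [this work].  Nothing here is cited as a published result.  The gluing rows served
[cite: KozmaNitzan2024, Conjecture 3 (p. 15)]; product measure [cite: Grimmett1999, §1.3 p. 10].
-/


noncomputable section

open scoped BigOperators

namespace Summit.CriticalPhenomena.PercolationContinuityZ3.Theorems
namespace Quant
namespace LawDec

open Finset

/-- the sub-forest law of the glued sibling of shape `(lo, K)`: `S(g) = {lo: 1−g, lo+K: g}` -/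
local notation3 "SP[" lo ", " K ", " a "]" => (fun h : ℕ => (1 - (a : ℝ)) * (if h = (lo : ℕ) then (1 : ℝ) else 0) +
  (a : ℝ) * (if h = (lo : ℕ) + (K : ℕ) then (1 : ℝ) else 0))

/-! ### Tight siblings of one shape among glued siblings of any shapes -/

/-- **GLUED SIBLINGS OF ARBITRARY SHAPES WHOSE TIGHT ONES SHARE A SHAPE `(lo₀, K₀)` — `K₀ ≤ 2lo₀` (ANY NUMBER) OR `K₀ ≤ 4lo₀` (AT MOST FIVE) — ARE SDEC AT
EVERY TREE-OK FLOOR.**  `0 < x`; `L`: siblings `⟨q,·,·,lo s + K s,{lo s: 1−g, lo s + K s: g}⟩`, `1 ≤ lo s, K s`, `0 < q, g < 1`, `x ≤ qg`; every tight `s`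
(`2·lo s < q·mean < lo s + (K s)·x`) has `lo s = lo₀`, `K s = K₀`; `lo₀ < K₀ ≤ 2lo₀`, or `lo₀ < K₀ ≤ 4lo₀` and `(L.filter tight).length ≤ 5` ⟹
`SDEC x (ftop L) (flaw L)`. [this work] -/
theorem sdec_gluedForests_of_tightShape5 (lo K : Sib → ℕ) (lo₀ K₀ : ℕ) {x : ℝ} (hx0 : 0 < x) (L : List Sib)
    (hL : ∀ s ∈ L, 1 ≤ lo s ∧ 1 ≤ K s ∧ s.M = lo s + K s ∧ 0 < s.q ∧ s.q < 1 ∧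
      ∃ g : ℝ, 0 < g ∧ g < 1 ∧ s.ρ = SP[lo s, K s, g] ∧ x ≤ s.q * g)
    (hshape : ∀ s ∈ L, 2 * (lo s : ℝ) < s.q * s.mean ∧ s.q * s.mean < (lo s : ℝ) + (K s) * x → lo s = lo₀ ∧ K s = K₀)
    (hcore : (lo₀ < K₀ ∧ K₀ ≤ 2 * lo₀) ∨ (lo₀ < K₀ ∧ K₀ ≤ 4 * lo₀ ∧
      (L.filter (fun s => decide (2 * (lo s : ℝ) < s.q * s.mean ∧ s.q * s.mean < (lo s : ℝ) + (K s) * x))).length ≤ 5)) :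
    SDEC x (ftop L) (flaw L) := by
  by_cases hnil : L = []
  · subst hnil; intro q _ _ j' hj'; exact absurd hj' (Nat.not_lt_zero _)
  obtain ⟨s₀, hs₀⟩ := List.exists_mem_of_ne_nil L hnil
  have hx1 : x < 1 := by
    obtain ⟨_, _, _, hq0, hq1, g, hg0, hg1, _, hx⟩ := hL s₀ hs₀
    nlinarith
  have facts : ∀ s ∈ L, s.LawOK ∧ x * (s.M : ℝ) ≤ s.q * s.mean := fun s hs =>
    ⟨(shapeSib_facts (lo s) (K s) (hL s hs).1 s (hL s hs).2.2).1, (shapeSib_facts (lo s) (K s) (hL s hs).1 s (hL s hs).2.2).2.1⟩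
  -- the tight core is a one-shape heavy forest of shape `(lo₀, K₀)`
  have hcoreL : ∀ s ∈ L.filter (fun s => decide (2 * (lo s : ℝ) < s.q * s.mean ∧ s.q * s.mean < (lo s : ℝ) + (K s) * x)),
      s.M = lo₀ + K₀ ∧ 0 < s.q ∧ s.q < 1 ∧ ∃ g : ℝ, 0 < g ∧ g < 1 ∧ s.ρ = SP[lo₀, K₀, g] ∧
        2 * (lo₀ : ℝ) ≤ s.q * ((lo₀ : ℝ) + K₀ * g) ∧ x ≤ s.q * g := by
    intro s hs
    obtain ⟨hsL, hb⟩ := List.mem_filter.1 hs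
    have ht : 2 * (lo s : ℝ) < s.q * s.mean ∧ s.q * s.mean < (lo s : ℝ) + (K s) * x := by simpa using hb
    obtain ⟨_, _, hM, hq0, hq1, g, hg0, hg1, hρ, hx⟩ := hL s hsL
    obtain ⟨_, _, _, cm⟩ := sp_laws (lo s) (K s) hg0.le hg1.le
    have hmean : s.mean = (lo s : ℝ) + (K s) * g := by unfold Sib.mean; rw [hM, hρ]; exact cm
    obtain ⟨e1, e2⟩ := hshape s hsL ht
    have hheavy : 2 * (lo s : ℝ) ≤ s.q * ((lo s : ℝ) + (K s) * g) := by rw [← hmean]; exact ht.1.le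
    rw [e1, e2] at hM hρ hheavy
    exact ⟨hM, hq0, hq1, g, hg0, hg1, hρ, hheavy, hx⟩
  have hS : SDEC x (ftop (L.filter (fun s => decide (2 * (lo s : ℝ) < s.q * s.mean ∧ s.q * s.mean < (lo s : ℝ) + (K s) * x))))
      (flaw (L.filter (fun s => decide (2 * (lo s : ℝ) < s.q * s.mean ∧ s.q * s.mean < (lo s : ℝ) + (K s) * x)))) := by
    rcases hcore with ⟨hloK, hK2⟩ | ⟨hloK, hK4, h3⟩
    · exact sdec_shapeForest_twoLo lo₀ K₀ hloK hK2 hx0 _ hcoreL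
    · exact sdec_shapeForest_long5 lo₀ K₀ hloK hK4 hx0 _ h3 hcoreL
  have hperm : (L.filter (fun s => !decide (2 * (lo s : ℝ) < s.q * s.mean ∧ s.q * s.mean < (lo s : ℝ) + (K s) * x)) ++
      L.filter (fun s => decide (2 * (lo s : ℝ) < s.q * s.mean ∧ s.q * s.mean < (lo s : ℝ) + (K s) * x))).Perm L :=
    (List.perm_append_comm).trans (List.filter_append_perm _ L)
  refine sdec_flaw_perm hperm ?_
  refine sdec_append_tame hx0 hx1 _ (fun t ht => (facts t (List.mem_of_mem_filter ht)).1)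
    (fun t ht => (facts t (List.mem_of_mem_filter ht)).2) hS _
    (fun s hs => (facts s (List.mem_of_mem_filter hs)).1) (fun s hs => (facts s (List.mem_of_mem_filter hs)).2) ?_
  intro s hs
  obtain ⟨hsL, hb⟩ := List.mem_filter.1 hs
  have hnt : ¬ (2 * (lo s : ℝ) < s.q * s.mean ∧ s.q * s.mean < (lo s : ℝ) + (K s) * x) := by
    intro hc
    simp [hc.1, hc.2] at hb
  exact shapeSib_tame_of_notTight (lo s) (K s) s (hL s hsL).2.2 hnt

/-! ### The node-shaped form -/

/-- **THE SIBLING STEP FOR GOOD SIBLINGS + GLUED SIBLINGS OF ANY SHAPES WHOSE TIGHT ONES FORM A ONE-SHAPE FAMILY (`K₀ ≤ 2lo₀`, or `K₀ ≤ 4lo₀` and ≤ 5) —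
NO ORACLE.**  `0 < x < 1`; `Lg` GOOD at `x` (law-OK, `x·M ≤ q·mean`, tame or hull+high — any sub-trees); `Lc` as in `sdec_gluedForests_of_tightShape5`; every
`L ~ Lg ++ Lc` ⟹ `SDEC x (ftop L) (flaw L)`. [this work] -/
theorem sdec_forest_gluedTightShapeCore5 (lo K : Sib → ℕ) (lo₀ K₀ : ℕ) {x : ℝ} (hx0 : 0 < x) (hx1 : x < 1) (Lg Lc L : List Sib)
    (hLg : ∀ s ∈ Lg, s.LawOK ∧ x * (s.M : ℝ) ≤ s.q * s.mean ∧
      ((∀ h : ℕ, 1 ≤ h → s.ρ h ≠ 0 → s.q * s.mean ≤ 2 * h ∨ x * ((s.M : ℝ) - h) ≤ s.q * s.mean - h) ∨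
        HullHigh x (s.q * s.mean) s.M (gate s.ρ s.q)))
    (hLc : ∀ s ∈ Lc, 1 ≤ lo s ∧ 1 ≤ K s ∧ s.M = lo s + K s ∧ 0 < s.q ∧ s.q < 1 ∧
      ∃ g : ℝ, 0 < g ∧ g < 1 ∧ s.ρ = SP[lo s, K s, g] ∧ x ≤ s.q * g)
    (hshape : ∀ s ∈ Lc, 2 * (lo s : ℝ) < s.q * s.mean ∧ s.q * s.mean < (lo s : ℝ) + (K s) * x → lo s = lo₀ ∧ K s = K₀)
    (hcore : (lo₀ < K₀ ∧ K₀ ≤ 2 * lo₀) ∨ (lo₀ < K₀ ∧ K₀ ≤ 4 * lo₀ ∧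
      (Lc.filter (fun s => decide (2 * (lo s : ℝ) < s.q * s.mean ∧ s.q * s.mean < (lo s : ℝ) + (K s) * x))).length ≤ 5))
    (hperm : (Lg ++ Lc).Perm L) :
    SDEC x (ftop L) (flaw L) := by
  have fc : ∀ s ∈ Lc, s.LawOK ∧ x * (s.M : ℝ) ≤ s.q * s.mean := fun s hs =>
    ⟨(shapeSib_facts (lo s) (K s) (hLc s hs).1 s (hLc s hs).2.2).1, (shapeSib_facts (lo s) (K s) (hLc s hs).1 s (hLc s hs).2.2).2.1⟩
  refine sdec_flaw_perm hperm ?_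
  exact sdec_append_good hx0 hx1 Lc (fun t ht => (fc t ht).1) (fun t ht => (fc t ht).2)
    (sdec_gluedForests_of_tightShape5 lo K lo₀ K₀ hx0 Lc hLc hshape hcore) Lg
    (fun s hs => (hLg s hs).1) (fun s hs => (hLg s hs).2.1) (fun s hs => (hLg s hs).2.2)

end LawDec
end Quant
end Summit.CriticalPhenomena.PercolationContinuityZ3.Theorems
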